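import Summits.AtomisticToContinuum.Crystallization.Theorems.ChartedPlanarOrderTubeConvexKernel
import Summits.AtomisticToContinuum.Crystallization.Theorems.OverbindingBudgetStackedRigidityUniq
import Summits.AtomisticToContinuum.Crystallization.Theorems.ChartedPlanarOrderCleanScaleP

/-!
# W′ «TubeConvex» — the ℓ²-monotone re-typing of the tube data, the E1′ GLUE `incr_eq_of_tubeConvex`, and the IsCleanW rebind of the PS column
(decomp-a2c lens-3 g24; critic row 458 (A): R1 — the scalar E1-dominance split `TubeMonotone ⟸ FarPairStiffnessL1 ∧ AdjacentPairDominance`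
(`…ChartedPlanarOrderTubeMonotoneSplit`, a TRUE but unfeedable glue) is RETIRED; R4 — PIVOT OF RECORD for slot 7c′ of lens-4's UniformCut cone:
W′ := the tube data re-typed as GLOBAL ℓ²-MONOTONICITY + the GLUE E1′ = discrete Liouville (`…ChartedPlanarOrderTubeConvexKernel`), combined with
critic row 457 R3 (`StressFree` + zero gap stress threaded; registry pinning 7c″ first; radii `ρ₀ = 1/40` provisional, `ρ₁ = 3/16`, `Λ₁ = 17/16`).)

WHY THE RE-TYPING.  `gapStress a b m h` is (minus) the gradient of the interlayer energy in the increment `h m`; the natural rigidity hypothesis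
is therefore monotonicity of the WHOLE map `h ↦ (gapStress a b m h)_m` — uniform convexity of the interlayer energy on the tube —, in which the
far (span `≥ 2`) tangential couplings enter with their SIGN (they help) and only the far NORMAL softening (`|·| ≈ 1.6` against the adjacent normal
stiffness `≈ 21`, README-dominance.md) must be absorbed: blockwise margins `≈ 3–10` at the fcc/hcp registry and `+0.56` window-wide in the
lateral block (lens-3 g23 §11; census TAG 161/161b), where the SCALAR own-gap dominance `Σ'κ − κ 0 < λ` of W `TubeMonotone(W)` is numerically
FALSE as typed for every `η ≥ 1/50` (TAG 161, W161.md e8d64cf4: `λ₁(1/50-ball) = 0.555 <` far mass `1.15` on the uniform T stack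
`(b, γ) = (1.03, 0.85)`).  The discrete Liouville theorem decouples `λ` from `κ`: `κ` (with its first moment) only pays the boundary terms.

## §1 Convex tube data (configuration level)
* `IsTubeLipschitz a b w ρ κ` (the `ℓ¹`-Lipschitz clause, unchanged), `IsTubeConvex a b w ρ λ` (★ ℓ²-monotonicity on finitely supported
  differences of `ρ`-tube profiles), `TubeConvexData a b w ρ := ∃ λ > 0, ∃ κ ≥ 0 summable with finite first moment, IsTubeConvex ∧ IsTubeLipschitz`
  — NO dominance relation between `λ` and `κ`;
* `tubeConvexData_of_scalar` — lens-4's / W's scalar tuple (`κ`, dominance `Σ'κ − κ 0 < λ`, own-increment monotonicity, Lipschitz) IMPLIES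
  `TubeConvexData` (kernel `convex_of_mono_dom`): ★ the Lean certificate that every convex statement below is WEAKER than its scalar twin;
* `tubeConvexData_anti` (a smaller radius is weaker).
## §2 The glue E1′ (PROVED; critic row 458 (A) TASK 1)
* ★ `incr_eq_of_tubeConvex : TubeConvexData a b w ρ → (∀ k, h' k ∈ tube w ρ k) → (∀ m, gapStress a b m (incr w) = gapStress a b m h') → incr w = h'`
  and the two-profile form `eq_of_tubeConvexData` (kernel `convex_unique`: general profiles `h'`, not only increments of stacked ones).
## §3 The statements (binder lists VERBATIM from the scalar twins, so consumers swap BY NAME)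
* `TubeConvex Λ η` (PS currency; twin of W `TubeMonotone Λ η`) · `TubeConvexW Λ ρ` (twin of `TubeMonotoneW`) · ★ `TubeConvexW' Λ ρ` — slot 7c′ OF
  RECORD (twin of lens-4's `TubeMonotoneW'`: `StressFree` + zero gap stress INCLUDED) · `TubeConvexRef Λ₁ ρ` (twin of 7c‴ `TubeMonotoneRef`);
  implications `tubeConvex_of_tubeMonotone`, `tubeConvexW_of_tubeMonotoneW`, `tubeConvexW'_of_tubeMonotoneW'`, `tubeConvexRef_of_tubeMonotoneRef`,
  `tubeConvexW'_of_W`, `tubeConvex_of_W` (all PROVED: WEAKER / currency).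
## §4 The E1′ glue BY NAME into lens-4's interface (part XX `…StackedRigidityUniq`, ASK l.2296 F2) and the composed cones (PROVED)
* ★ `tubeUniquenessW_of_tubeConvexW' : TubeConvexW' Λ₁ ρ → TubeUniquenessW Λ₁ ρ` (the requested target, from the WEAKEST convex statement),
  `tubeUniquenessW_of_tubeConvexW : TubeConvexW Λ₁ ρ → TubeUniquenessW Λ₁ ρ` (the literal F2 name), `tubeUniquenessRef_of_tubeConvexRef :
  TubeConvexRef Λ₁ ρ → TubeUniquenessRef Λ₁ ρ` (reference-centred twin);
* the critic's `rdef_of_grossU_shape_gluing_pinning_convexW Λ Λ₁ ρ₀ ρ₁` (= lens-4's SIXTEENTH-interface cone `…_pinning_uniqW` ∘ the feeder, slot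
  7c′ := `TubeConvexW Λ₁ ρ₀`), its weakest form `…_pinning_convexW'` (7c′ := `TubeConvexW' Λ₁ ρ₀`) and the reference-centred `…_pinning_convexRef`
  (= `…_pinning_uniqRef` ∘ feeder, 7c‴ := `TubeConvexRef Λ₁ ρ₀`) — one line each; lens-4 owns the cone's typing, these are the compositions on offer.
## §5 The PS column re-assembled on E1′ (PROVED) and its IsCleanW rebind (critic row 458 (A) TASK 2)
* E1′ `SlavingKernelConvex` (Prop) + `slavingKernelConvex_holds` (kernel `convex_translation`); ★ `profileSlavingLJ_of_convex : NashBalance Λ →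
  TubeConvex Λ η → ProfileSlavingLJ Λ η`, `profileSlavingLJ_of_tubeConvex : TubeConvex Λ η → ProfileSlavingLJ Λ η` (D1 `nashBalance_holds`):
  the PS column now reads `PS_LJ(Λ, η) ⟸ W′ TubeConvex Λ η` ALONE;
* W currency: `ProfileSlavingLJW Λ η` (`IsClean ↦ IsCleanW`, STRONGER: `profileSlavingLJ_of_W`) and ★ `profileSlavingLJW_of_tubeConvexW :
  TubeConvexW Λ η → ProfileSlavingLJW Λ η` (independence `…CleanScaleP.cleanStackedIndependentW`, balance `…StackedRigidityW.gapStress_const_of_indep`, E1′).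
Tags: `IsTubeLipschitz` [ANALYTIC · WEAKER · ATTACKABLE: `τ_s ≤ C (s(h₀−ρ))⁻⁶` from the landed Lipschitz bricks]; `IsTubeConvex` [CERT · INSTRUMENTABLE:
normal-block dominance + tangential positivity, census TAG 161b]; registry pinning / basal reference unchanged (lens-4 part XIX).
Mathlib + the cited tree modules only; `[folklore]`; no instances, no notation; sorry-free.
-/

noncomputable section

namespace Summit.AtomisticToContinuum.Crystallization.Theorems.ChartedPlanarOrderTubeConvex

open Metric Filter Topology
open scoped RealInnerProductSpace
open Summit.AtomisticToContinuum.Crystallization.Theses.OverbindingBudget (RobustDefectLimitWindows)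
open Summit.AtomisticToContinuum.Crystallization.Theses.PricedLinkCensus (ChargedEnergyGap)
open Summit.AtomisticToContinuum.Crystallization.Theorems.OverbindingBudgetGradedBareness (CleanlessExcessT)
open Summit.AtomisticToContinuum.Crystallization.Theorems.OverbindingBudgetCoherentCut (CoherentResidual)
open Summit.AtomisticToContinuum.Crystallization.Theorems.OverbindingBudgetUniformCutStatements (GrossCleanBallsU)
open Summit.AtomisticToContinuum.Crystallization.Theorems.OverbindingBudgetElasticSplitScale (CompressedVirialLaw)
open Summit.AtomisticToContinuum.Crystallization.Theorems.OverbindingBudgetElasticSplitShear (StressFree)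
open Summit.AtomisticToContinuum.Crystallization.Theorems.ChartedPlanarOrderChunkFloor (E3)
open Summit.AtomisticToContinuum.Crystallization.Theorems.ChartedPlanarOrderRigidityDoor (IsClean IsNash)
open Summit.AtomisticToContinuum.Crystallization.Theorems.ChartedPlanarOrderDensityDichotomy (μS IsSep)
open Summit.AtomisticToContinuum.Crystallization.Theorems.ChartedPlanarOrderDoorLayered (Layered)
open Summit.AtomisticToContinuum.Crystallization.Theorems.ChartedPlanarOrderProfileSlavingLJ (IsStacked gapStress incr tube NashBalance
  TubeMonotone ProfileSlavingLJ)
open Summit.AtomisticToContinuum.Crystallization.Theorems.ChartedPlanarOrderTubeMonotoneSplit (eta_nonneg incr_mem_tube norm_sub_le_two_eta)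
open Summit.AtomisticToContinuum.Crystallization.Theorems.ChartedPlanarOrderStraddleSummable (nashBalance_holds)
open Summit.AtomisticToContinuum.Crystallization.Theorems.ChartedPlanarOrderCleanScaleP (cleanStackedIndependentW)
open Summit.AtomisticToContinuum.Crystallization.Theorems.OverbindingBudgetPeriodicCleanOrStrained (UniformlyClean)
open Summit.AtomisticToContinuum.Crystallization.Theorems.OverbindingBudgetScaleWidening (IsCleanW DoorPeriodicW isClean_imp_W)
open Summit.AtomisticToContinuum.Crystallization.Theorems.OverbindingBudgetTwoShellShape (TwoShellShape BarlowGluingW)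
open Summit.AtomisticToContinuum.Crystallization.Theorems.OverbindingBudgetStackedRigidityW (StackedReductionW GapStressVanishesW
  BasalReferenceW TubeMonotoneW gapStress_const_of_indep)
open Summit.AtomisticToContinuum.Crystallization.Theorems.OverbindingBudgetStackedRigidityRef (TubeMonotoneW' RegistryPinningW TubeMonotoneRef
  BasalReferenceCW tubeMonotoneW'_of_W)
open Summit.AtomisticToContinuum.Crystallization.Theorems.OverbindingBudgetStackedRigidityUniq (TubeUniquenessW TubeUniquenessRef
  rdef_of_grossU_shape_gluing_pinning_uniqW rdef_of_grossU_shape_gluing_pinning_uniqRef)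
open Summit.AtomisticToContinuum.Crystallization.Theorems.ChartedPlanarOrderTubeConvexKernel (convex_unique convex_translation
  convex_of_mono_dom)

/-! ## §1 Convex tube data (configuration level) -/

/-- the `ℓ¹`-Lipschitz clause of the tube data round `w` at radius `ρ` with weights `κ` (unchanged from W / lens-4):
`‖gapStress m h − gapStress m h'‖ ≤ Σ'_j κ j ‖h (m+j) − h' (m+j)‖` for `ρ`-tube profiles. [ANALYTIC · WEAKER · ATTACKABLE] -/
def IsTubeLipschitz (a b : E3) (w : ℤ → E3) (ρ : ℝ) (κ : ℤ → ℝ) : Prop :=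
  ∀ m : ℤ, ∀ h h' : ℤ → E3, (∀ k, h k ∈ tube w ρ k) → (∀ k, h' k ∈ tube w ρ k) →
    ‖gapStress a b m h - gapStress a b m h'‖ ≤ ∑' j : ℤ, κ j * ‖h (m + j) - h' (m + j)‖

/-- ★ W′'s new clause · **ℓ²-monotonicity of the WHOLE gap-stress map** round `w` at radius `ρ` with constant `λ`: for every finite set `F` of gaps
and every two `ρ`-tube increment profiles that agree off `F`, `λ Σ_{m∈F} ‖h m − h' m‖² ≤ Σ_{m∈F} ⟪gapStress m h − gapStress m h', h m − h' m⟫`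
(uniform convexity of the interlayer energy on the tube; far tangential couplings enter with their sign). [CERT · INSTRUMENTABLE, TAG 161b] -/
def IsTubeConvex (a b : E3) (w : ℤ → E3) (ρ lam : ℝ) : Prop :=
  ∀ (F : Finset ℤ) (h h' : ℤ → E3), (∀ k, h k ∈ tube w ρ k) → (∀ k, h' k ∈ tube w ρ k) → (∀ k, k ∉ F → h k = h' k) →
    lam * ∑ m ∈ F, ‖h m - h' m‖ ^ 2 ≤ ∑ m ∈ F, ⟪gapStress a b m h - gapStress a b m h', h m - h' m⟫

/-- **convex tube data** round `w` at radius `ρ`: a monotonicity constant `λ > 0` and summable Lipschitz weights `κ ≥ 0` with finite first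
moment — with NO dominance relation between `λ` and `κ`. -/
def TubeConvexData (a b : E3) (w : ℤ → E3) (ρ : ℝ) : Prop :=
  ∃ (lam : ℝ) (κ : ℤ → ℝ), 0 < lam ∧ (∀ j, 0 ≤ κ j) ∧ Summable κ ∧ Summable (fun j : ℤ => |(j : ℝ)| * κ j) ∧
    IsTubeConvex a b w ρ lam ∧ IsTubeLipschitz a b w ρ κ

/-- ★ **the scalar tube data IMPLY the convex data** (kernel `convex_of_mono_dom`, `λ' = λ − (Σ'κ − κ 0)`): every convex statement of this file is
WEAKER than its scalar twin. [this file] -/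
theorem tubeConvexData_of_scalar {a b : E3} {w : ℤ → E3} {ρ lam : ℝ} {κ : ℤ → ℝ}
    (hκ0 : ∀ j, 0 ≤ κ j) (hκs : Summable κ) (hκ1 : Summable (fun j : ℤ => |(j : ℝ)| * κ j)) (hdom : (∑' j, κ j) - κ 0 < lam)
    (hmono : ∀ m : ℤ, ∀ h : ℤ → E3, (∀ k, h k ∈ tube w ρ k) → ∀ b' ∈ tube w ρ m,
      lam * ‖h m - b'‖ ^ 2 ≤ ⟪gapStress a b m h - gapStress a b m (Function.update h m b'), h m - b'⟫)
    (hlip : ∀ m : ℤ, ∀ h h' : ℤ → E3, (∀ k, h k ∈ tube w ρ k) → (∀ k, h' k ∈ tube w ρ k) →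
      ‖gapStress a b m h - gapStress a b m h'‖ ≤ ∑' j : ℤ, κ j * ‖h (m + j) - h' (m + j)‖) : TubeConvexData a b w ρ :=
  ⟨lam - ((∑' j, κ j) - κ 0), κ, by linarith, hκ0, hκs, hκ1,
    fun F h h' hh hh' hF => convex_of_mono_dom (gapStress a b) (tube w ρ) κ hκ0 hκs hmono hlip F h h' hh hh' hF, hlip⟩

/-- a smaller radius is weaker: `TubeConvexData a b w ρ → TubeConvexData a b w ρ'` for `ρ' ≤ ρ`. [this file] -/
theorem tubeConvexData_anti {a b : E3} {w : ℤ → E3} {ρ ρ' : ℝ} (h : TubeConvexData a b w ρ) (hρ : ρ' ≤ ρ) :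
    TubeConvexData a b w ρ' := by
  obtain ⟨lam, κ, hlam, hκ0, hκs, hκ1, hconv, hlip⟩ := h
  have hsub : ∀ {g : ℤ → E3}, (∀ k, g k ∈ tube w ρ' k) → ∀ k, g k ∈ tube w ρ k := fun hg k => closedBall_subset_closedBall hρ (hg k)
  exact ⟨lam, κ, hlam, hκ0, hκs, hκ1, fun F g g' hg hg' hF => hconv F g g' (hsub hg) (hsub hg') hF,
    fun m g g' hg hg' => hlip m g g' (hsub hg) (hsub hg')⟩

/-! ## §2 The glue E1′ (critic row 458 (A) TASK 1) -/

/-- **Two `ρ`-tube profiles with equal gap stresses coincide** (convex data; kernel `convex_unique` with `B = 2ρ`). [this file] -/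
theorem eq_of_tubeConvexData {a b : E3} {w h h' : ℤ → E3} {ρ : ℝ} (hW : TubeConvexData a b w ρ) (hh : ∀ k, h k ∈ tube w ρ k)
    (hh' : ∀ k, h' k ∈ tube w ρ k) (heq : ∀ m, gapStress a b m h = gapStress a b m h') : h = h' := by
  obtain ⟨lam, κ, hlam, hκ0, hκs, hκ1, hconv, hlip⟩ := hW
  exact convex_unique (gapStress a b) (tube w ρ) κ hκ0 hκs hκ1 hlam hconv hlip h h' hh hh' (norm_sub_le_two_eta hh hh') heq

/-- ★ **GLUE E1′ · `incr_eq_of_tubeConvex`.**  Convex tube data round `w`, a profile `h'` in the tube with the same gap stresses as `incr w` ⇒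
`incr w = h'`.  (Slot 7c′'s consumer: with `h' = incr w'` both stresses vanish after slot 7b.) [this file] -/
theorem incr_eq_of_tubeConvex {a b : E3} {w h' : ℤ → E3} {ρ : ℝ} (hW : TubeConvexData a b w ρ) (hh' : ∀ k, h' k ∈ tube w ρ k)
    (heq : ∀ m, gapStress a b m (incr w) = gapStress a b m h') : incr w = h' :=
  eq_of_tubeConvexData hW (fun k => incr_mem_tube (eta_nonneg hh') k) hh' heq

/-! ## §3 The statements -/

/-- **W′ · `TubeConvex Λ η`** (PS currency; binder list of W `TubeMonotone Λ η` VERBATIM): round every clean separated Nash stacked layered LJ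
configuration with in-plane periods of norm `≤ Λ` the gap-stress map carries CONVEX tube data at radius `η`.  Why it might fail: the far normal
softening must stay below the adjacent normal stiffness uniformly on the tube (blockwise margin `≈ 3–10` at registry; thin near the compressed edge
`b = 0.90` of the clean window). [CERT · INSTRUMENTABLE, TAG 161b] [piece] -/
def TubeConvex (Λ η : ℝ) : Prop :=
  ∀ δ : ℝ, 0 < δ → ∀ (a b : E3) (w : ℤ → E3), ‖a‖ ≤ Λ → ‖b‖ ≤ Λ →
    IsSep δ (Layered a b w) → IsClean (μS (Layered a b w)) → IsNash (μS (Layered a b w)) → IsStacked a b w →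
    TubeConvexData a b w η

/-- **`TubeConvexW Λ ρ`** (W currency, `IsClean ↦ IsCleanW`; binder list of lens-4's `TubeMonotoneW Λ ρ` VERBATIM; STRONGER than `TubeConvex`). [piece] -/
def TubeConvexW (Λ ρ : ℝ) : Prop :=
  ∀ δ : ℝ, 0 < δ → ∀ (a b : E3) (w : ℤ → E3), ‖a‖ ≤ Λ → ‖b‖ ≤ Λ →
    IsSep δ (Layered a b w) → IsCleanW (μS (Layered a b w)) → IsNash (μS (Layered a b w)) → IsStacked a b w →
    TubeConvexData a b w ρ

/-- ★ **slot 7c′ OF RECORD · `TubeConvexW' Λ ρ`** (binder list of lens-4's `TubeMonotoneW' Λ ρ` VERBATIM: `StressFree (Layered a b w)` and zero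
transmitted stress across every gap INCLUDED — the domain the seam is applied to after slot 7b; WEAKEST of the three): convex tube data at radius
`ρ` round every admissible zero-gap-stress stacked configuration.  Of record at `(Λ, ρ) = (17/16, 1/40)` (`ρ₀` provisional, census TAG 161b (i)).
Why it might fail: as `TubeConvex`. [CERT · INSTRUMENTABLE] [piece] -/
def TubeConvexW' (Λ ρ : ℝ) : Prop :=
  ∀ δ : ℝ, 0 < δ → ∀ (a b : E3) (w : ℤ → E3), ‖a‖ ≤ Λ → ‖b‖ ≤ Λ →
    IsSep δ (Layered a b w) → IsCleanW (μS (Layered a b w)) → IsNash (μS (Layered a b w)) → IsStacked a b w →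
    StressFree (Layered a b w) → (∀ m : ℤ, gapStress a b m (incr w) = 0) → TubeConvexData a b w ρ

/-- **`TubeConvexRef Λ₁ ρ`** (binder list of lens-4's 7c‴ `TubeMonotoneRef Λ₁ ρ` VERBATIM; currency-free): convex tube data at radius `ρ` round
every `δ`-separated stacked REFERENCE profile over independent periods of norm `≤ Λ₁` with two-shell-clean (W), uniformly clean layered set and
zero gap stresses — the census's stress-free registry rows, ball centred where the Hessian is measured. [CERT · INSTRUMENTABLE] [piece] -/
def TubeConvexRef (Λ₁ ρ : ℝ) : Prop :=
  ∀ δ : ℝ, 0 < δ → ∀ (a b : E3) (w' : ℤ → E3), IsStacked a b w' → LinearIndependent ℝ ![a, b] → ‖a‖ ≤ Λ₁ → ‖b‖ ≤ Λ₁ →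
    IsSep δ (Layered a b w') → IsCleanW (μS (Layered a b w')) → (∀ m : ℤ, gapStress a b m (incr w') = 0) →
    UniformlyClean (Layered a b w') → TubeConvexData a b w' ρ

/-- `TubeMonotone Λ η → TubeConvex Λ η` (W′ is WEAKER than W). [this file] -/
theorem tubeConvex_of_tubeMonotone {Λ η : ℝ} (h : TubeMonotone Λ η) : TubeConvex Λ η := by
  intro δ hδ a b w ha hb hs hc hn hst
  obtain ⟨lam, κ, hκ0, hκs, hκ1, hdom, hmono, hlip⟩ := h δ hδ a b w ha hb hs hc hn hst
  exact tubeConvexData_of_scalar hκ0 hκs hκ1 hdom hmono hlip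

/-- `TubeMonotoneW Λ ρ → TubeConvexW Λ ρ` (WEAKER). [this file] -/
theorem tubeConvexW_of_tubeMonotoneW {Λ ρ : ℝ} (h : TubeMonotoneW Λ ρ) : TubeConvexW Λ ρ := by
  intro δ hδ a b w ha hb hs hc hn hst
  obtain ⟨lam, κ, hκ0, hκs, hκ1, hdom, hmono, hlip⟩ := h δ hδ a b w ha hb hs hc hn hst
  exact tubeConvexData_of_scalar hκ0 hκs hκ1 hdom hmono hlip

/-- ★ `TubeMonotoneW' Λ ρ → TubeConvexW' Λ ρ` (slot 7c′: the convex statement of record is WEAKER than lens-4's scalar one). [this file] -/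
theorem tubeConvexW'_of_tubeMonotoneW' {Λ ρ : ℝ} (h : TubeMonotoneW' Λ ρ) : TubeConvexW' Λ ρ := by
  intro δ hδ a b w ha hb hs hc hn hst hf hz
  obtain ⟨lam, κ, hκ0, hκs, hκ1, hdom, hmono, hlip⟩ := h δ hδ a b w ha hb hs hc hn hst hf hz
  exact tubeConvexData_of_scalar hκ0 hκs hκ1 hdom hmono hlip

/-- `TubeMonotoneRef Λ₁ ρ → TubeConvexRef Λ₁ ρ` (WEAKER). [this file] -/
theorem tubeConvexRef_of_tubeMonotoneRef {Λ₁ ρ : ℝ} (h : TubeMonotoneRef Λ₁ ρ) : TubeConvexRef Λ₁ ρ := by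
  intro δ hδ a b w' hst hab ha hb hs hc hz hUC
  obtain ⟨lam, κ, hκ0, hκs, hκ1, hdom, hmono, hlip⟩ := h δ hδ a b w' hst hab ha hb hs hc hz hUC
  exact tubeConvexData_of_scalar hκ0 hκs hκ1 hdom hmono hlip

/-- `TubeConvexW Λ ρ → TubeConvexW' Λ ρ` (forget the two extra hypotheses). [this file] -/
theorem tubeConvexW'_of_W {Λ ρ : ℝ} (h : TubeConvexW Λ ρ) : TubeConvexW' Λ ρ :=
  fun δ hδ a b w ha hb hs hc hn hst _ _ => h δ hδ a b w ha hb hs hc hn hst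

/-- `TubeConvexW Λ η → TubeConvex Λ η` (currency: `IsClean → IsCleanW`). [this file] -/
theorem tubeConvex_of_W {Λ η : ℝ} (h : TubeConvexW Λ η) : TubeConvex Λ η :=
  fun δ hδ a b w ha hb hs hc hn hst => h δ hδ a b w ha hb hs (isClean_imp_W hc) hn hst

/-- `TubeMonotoneW Λ ρ → TubeConvexW' Λ ρ` (the retired 7c implies the 7c′ of record). [this file] -/
theorem tubeConvexW'_of_tubeMonotoneW {Λ ρ : ℝ} (h : TubeMonotoneW Λ ρ) : TubeConvexW' Λ ρ :=
  tubeConvexW'_of_tubeMonotoneW' (tubeMonotoneW'_of_W h)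

/-! ## §4 The E1′ glue BY NAME into lens-4's interface, and the composed cones -/

/-- ★ **E1′ BY NAME · `TubeConvexW' Λ₁ ρ → TubeUniquenessW Λ₁ ρ`** (lens-4 ASK l.2296 F2, from the WEAKEST convex statement; `incr_eq_of_tubeConvex`
with `h' = incr w'`; the independence binder of `TubeUniquenessW` is not used). [this file] -/
theorem tubeUniquenessW_of_tubeConvexW' {Λ₁ ρ : ℝ} (hT : TubeConvexW' Λ₁ ρ) : TubeUniquenessW Λ₁ ρ := by
  intro δ hδ a b w hst _hab ha hb hsep hcl hna hsf hzero w' _hst' htube hzero'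
  exact (incr_eq_of_tubeConvex (hT δ hδ a b w ha hb hsep hcl hna hst hsf hzero) htube (fun m => by rw [hzero m, hzero' m])).symm

/-- **`TubeConvexW Λ₁ ρ → TubeUniquenessW Λ₁ ρ`** (the literal F2 name). [this file] -/
theorem tubeUniquenessW_of_tubeConvexW {Λ₁ ρ : ℝ} (hT : TubeConvexW Λ₁ ρ) : TubeUniquenessW Λ₁ ρ :=
  tubeUniquenessW_of_tubeConvexW' (tubeConvexW'_of_W hT)

/-- **`TubeConvexRef Λ₁ ρ → TubeUniquenessRef Λ₁ ρ`** (reference-centred twin: convex data round the reference `w'`, tube round `w'`). [this file] -/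
theorem tubeUniquenessRef_of_tubeConvexRef {Λ₁ ρ : ℝ} (hT : TubeConvexRef Λ₁ ρ) : TubeUniquenessRef Λ₁ ρ := by
  intro δ hδ a b w' hst' hab ha hb hsep hcl hzero' hUC w _hst htube hzero
  exact (incr_eq_of_tubeConvex (hT δ hδ a b w' hst' hab ha hb hsep hcl hzero' hUC) htube (fun m => by rw [hzero m, hzero' m])).symm

/-- ★ **RDEF cone · the critic's `rdef_of_grossU_shape_gluing_pinning_convexW`** (every `Λ`, `Λ₁`, `ρ₀`, `ρ₁`; of record candidate at
`(2, 17/16; 1/40, 3/16)`): lens-4's SIXTEENTH-interface cone `…_pinning_uniqW` with slot 7c♭ fed by 7c′ := `TubeConvexW Λ₁ ρ₀`. [this file] -/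
theorem rdef_of_grossU_shape_gluing_pinning_convexW (Λ Λ₁ ρ₀ ρ₁ : ℝ) (hG : GrossCleanBallsU (1 / 250) 10) (hCEG : ChargedEnergyGap)
    (hC : CompressedVirialLaw (1 / 250) 10) (hS : TwoShellShape (1 / 100) (3 / 50) (1 / 450)) (hB₂ : BarlowGluingW) (hD : DoorPeriodicW Λ)
    (hSR : StackedReductionW Λ Λ₁) (hV : GapStressVanishesW Λ₁) (hP : RegistryPinningW Λ₁ ρ₀ ρ₁) (hT : TubeConvexW Λ₁ ρ₀)
    (hRef : BasalReferenceW Λ₁ ρ₁) (hCE : CleanlessExcessT) (hRes : CoherentResidual 10) : RobustDefectLimitWindows :=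
  rdef_of_grossU_shape_gluing_pinning_uniqW Λ Λ₁ ρ₀ ρ₁ hG hCEG hC hS hB₂ hD hSR hV hP (tubeUniquenessW_of_tubeConvexW hT) hRef hCE hRes

/-- ★ **RDEF cone, weakest convex form `…_pinning_convexW'`**: the same with 7c′ := `TubeConvexW' Λ₁ ρ₀` (stress-free + zero gap stress threaded,
critic row 457 R3; implied by lens-4's scalar `TubeMonotoneW' Λ₁ ρ₀` via `tubeConvexW'_of_tubeMonotoneW'`). [this file] -/
theorem rdef_of_grossU_shape_gluing_pinning_convexW' (Λ Λ₁ ρ₀ ρ₁ : ℝ) (hG : GrossCleanBallsU (1 / 250) 10) (hCEG : ChargedEnergyGap)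
    (hC : CompressedVirialLaw (1 / 250) 10) (hS : TwoShellShape (1 / 100) (3 / 50) (1 / 450)) (hB₂ : BarlowGluingW) (hD : DoorPeriodicW Λ)
    (hSR : StackedReductionW Λ Λ₁) (hV : GapStressVanishesW Λ₁) (hP : RegistryPinningW Λ₁ ρ₀ ρ₁) (hT : TubeConvexW' Λ₁ ρ₀)
    (hRef : BasalReferenceW Λ₁ ρ₁) (hCE : CleanlessExcessT) (hRes : CoherentResidual 10) : RobustDefectLimitWindows :=
  rdef_of_grossU_shape_gluing_pinning_uniqW Λ Λ₁ ρ₀ ρ₁ hG hCEG hC hS hB₂ hD hSR hV hP (tubeUniquenessW_of_tubeConvexW' hT) hRef hCE hRes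

/-- **RDEF cone, reference-centred convex form `…_pinning_convexRef`**: lens-4's SEVENTEENTH-interface cone `…_pinning_uniqRef` with 7c♭‴ fed by
7c‴ := `TubeConvexRef Λ₁ ρ₀` (census objects = references; currency-free). [this file] -/
theorem rdef_of_grossU_shape_gluing_pinning_convexRef (Λ Λ₁ ρ₀ ρ₁ : ℝ) (hG : GrossCleanBallsU (1 / 250) 10) (hCEG : ChargedEnergyGap)
    (hC : CompressedVirialLaw (1 / 250) 10) (hS : TwoShellShape (1 / 100) (3 / 50) (1 / 450)) (hB₂ : BarlowGluingW) (hD : DoorPeriodicW Λ)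
    (hSR : StackedReductionW Λ Λ₁) (hV : GapStressVanishesW Λ₁) (hP : RegistryPinningW Λ₁ ρ₀ ρ₁) (hT : TubeConvexRef Λ₁ ρ₀)
    (hRef : BasalReferenceCW Λ₁ ρ₁) (hCE : CleanlessExcessT) (hRes : CoherentResidual 10) : RobustDefectLimitWindows :=
  rdef_of_grossU_shape_gluing_pinning_uniqRef Λ Λ₁ ρ₀ ρ₁ hG hCEG hC hS hB₂ hD hSR hV hP (tubeUniquenessRef_of_tubeConvexRef hT) hRef hCE hRes

/-! ## §5 The PS column on E1′, and its IsCleanW rebind (critic row 458 (A) TASK 2) -/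

/-- **E1′ «SlavingKernelConvex»** — E1 `SlavingKernelL1` with the scalar hypotheses (dominance `Σ'κ − κ 0 < λ`, own-increment monotonicity)
REPLACED by `0 < λ` and ℓ²-monotonicity on finitely supported differences; everything else binder for binder. [ANALYTIC · PROVED below] [piece] -/
def SlavingKernelConvex : Prop :=
  ∀ (Φ : ℤ → (ℤ → E3) → E3) (W : ℤ → Set E3) (lam : ℝ) (κ : ℤ → ℝ),
    (∀ j, 0 ≤ κ j) → Summable κ → Summable (fun j : ℤ => |(j : ℝ)| * κ j) → 0 < lam →
    (∀ (F : Finset ℤ) (h h' : ℤ → E3), (∀ k, h k ∈ W k) → (∀ k, h' k ∈ W k) → (∀ k, k ∉ F → h k = h' k) →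
      lam * ∑ m ∈ F, ‖h m - h' m‖ ^ 2 ≤ ∑ m ∈ F, ⟪Φ m h - Φ m h', h m - h' m⟫) →
    (∀ m : ℤ, ∀ h h' : ℤ → E3, (∀ k, h k ∈ W k) → (∀ k, h' k ∈ W k) →
      ‖Φ m h - Φ m h'‖ ≤ ∑' j : ℤ, κ j * ‖h (m + j) - h' (m + j)‖) →
    ∀ w w' : ℤ → E3, (∀ k, w k - w (k - 1) ∈ W k) → (∀ k, w' k - w' (k - 1) ∈ W k) →
    ∀ σ σ' : E3, (∀ m, Φ m (fun k => w k - w (k - 1)) = σ) → (∀ m, Φ m (fun k => w' k - w' (k - 1)) = σ') →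
    ∀ D : ℝ, (∀ m, ‖w m - w' m‖ ≤ D) → ∃ c : E3, ∀ m, w' m = w m + c

/-- ★ **E1′ HOLDS** (kernel `convex_translation`). [this file] -/
theorem slavingKernelConvex_holds : SlavingKernelConvex :=
  fun Φ W _lam κ hκ0 hκs hκ1 hlam hconv hlip w w' hg hg' σ σ' hσ hσ' D hD =>
    convex_translation Φ W κ hκ0 hκs hκ1 hlam hconv hlip w w' hg hg' σ σ' hσ hσ' D hD

/-- ★ **PS_LJ from D1 and W′** (twin of `…ProfileSlavingLJ.profileSlavingLJ_of` on E1′): `NashBalance Λ → TubeConvex Λ η → ProfileSlavingLJ Λ η`. -/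
theorem profileSlavingLJ_of_convex {Λ η : ℝ} (hB : NashBalance Λ) (hW : TubeConvex Λ η) : ProfileSlavingLJ Λ η := by
  intro δ hδ a b w w' ha hb hs hc hn hst hs' hc' hn' hst' hD hη
  obtain ⟨D, hD⟩ := hD
  obtain ⟨lam, κ, hlam, hκ0, hκs, hκ1, hconv, hlip⟩ := hW δ hδ a b w ha hb hs hc hn hst
  obtain ⟨σ, hσ⟩ := hB δ hδ a b w ha hb hs hc hn hst
  obtain ⟨σ', hσ'⟩ := hB δ hδ a b w' ha hb hs' hc' hn' hst'
  have hη0 : 0 ≤ η := le_trans (norm_nonneg _) (hη 0)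
  refine convex_translation (gapStress a b) (tube w η) κ hκ0 hκs hκ1 hlam hconv hlip w w' (fun k => mem_closedBall_self hη0)
    (fun k => ?_) σ σ' hσ hσ' D (fun m => by rw [norm_sub_rev]; exact hD m)
  show w' k - w' (k - 1) ∈ closedBall (w k - w (k - 1)) η
  rw [mem_closedBall, dist_eq_norm]
  exact hη k

/-- ★ **`PS_LJ(Λ, η) ⟸ W′ TubeConvex Λ η` ALONE** (E1′ + D1 `…StraddleSummable.nashBalance_holds`). [this file] -/
theorem profileSlavingLJ_of_tubeConvex {Λ η : ℝ} (hW : TubeConvex Λ η) : ProfileSlavingLJ Λ η :=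
  profileSlavingLJ_of_convex (nashBalance_holds Λ) hW

/-- **PS_LJ in W currency · `ProfileSlavingLJW Λ η`** (`IsClean ↦ IsCleanW` in all four cleanliness binders; STRONGER than `ProfileSlavingLJ Λ η`). [piece] -/
def ProfileSlavingLJW (Λ η : ℝ) : Prop :=
  ∀ δ : ℝ, 0 < δ → ∀ (a b : E3) (w w' : ℤ → E3), ‖a‖ ≤ Λ → ‖b‖ ≤ Λ →
    IsSep δ (Layered a b w) → IsCleanW (μS (Layered a b w)) → IsNash (μS (Layered a b w)) → IsStacked a b w →
    IsSep δ (Layered a b w') → IsCleanW (μS (Layered a b w')) → IsNash (μS (Layered a b w')) → IsStacked a b w' →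
    (∃ D : ℝ, ∀ m, ‖w' m - w m‖ ≤ D) → (∀ m, ‖(w' m - w' (m - 1)) - (w m - w (m - 1))‖ ≤ η) →
    ∃ c : E3, ∀ m, w' m = w m + c

/-- `ProfileSlavingLJW Λ η → ProfileSlavingLJ Λ η` (currency). [this file] -/
theorem profileSlavingLJ_of_W {Λ η : ℝ} (h : ProfileSlavingLJW Λ η) : ProfileSlavingLJ Λ η :=
  fun δ hδ a b w w' ha hb hs hc hn hst hs' hc' hn' hst' hD hη =>
    h δ hδ a b w w' ha hb hs (isClean_imp_W hc) hn hst hs' (isClean_imp_W hc') hn' hst' hD hη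

/-- ★ **PS_LJ in W currency from `TubeConvexW` ALONE** (independence `…CleanScaleP.cleanStackedIndependentW`; constant gap stress
`…StackedRigidityW.gapStress_const_of_indep`; E1′). [this file] -/
theorem profileSlavingLJW_of_tubeConvexW {Λ η : ℝ} (hW : TubeConvexW Λ η) : ProfileSlavingLJW Λ η := by
  intro δ hδ a b w w' ha hb hs hc hn hst hs' hc' hn' hst' hD hη
  obtain ⟨D, hD⟩ := hD
  have hab : LinearIndependent ℝ ![a, b] := cleanStackedIndependentW δ hδ a b w hs hc hst
  obtain ⟨lam, κ, hlam, hκ0, hκs, hκ1, hconv, hlip⟩ := hW δ hδ a b w ha hb hs hc hn hst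
  obtain ⟨σ, hσ⟩ := gapStress_const_of_indep hδ hab hst hs hn
  obtain ⟨σ', hσ'⟩ := gapStress_const_of_indep hδ hab hst' hs' hn'
  have hη0 : 0 ≤ η := le_trans (norm_nonneg _) (hη 0)
  refine convex_translation (gapStress a b) (tube w η) κ hκ0 hκs hκ1 hlam hconv hlip w w' (fun k => mem_closedBall_self hη0)
    (fun k => ?_) σ σ' hσ hσ' D (fun m => by rw [norm_sub_rev]; exact hD m)
  show w' k - w' (k - 1) ∈ closedBall (w k - w (k - 1)) η
  rw [mem_closedBall, dist_eq_norm]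
  exact hη k

end Summit.AtomisticToContinuum.Crystallization.Theorems.ChartedPlanarOrderTubeConvex

end
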